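import Summits.Langlands.Langlands.Theorems.SoloInformedWittDigits

/-!
# Weighted digit bounds on Witt vectors and leading-digit stability (solo programme, s78)

For a `DigitNorm` on a perfect domain `R` of characteristic `p` (a valuation `v ≤ 1` with valuation-ring
divisibility and a base `0 < ϱ < 1`; think `R = 𝒪_{ℂ_p}♭`, `v(x) = ‖x♯‖`, `ϱ = ‖p‖`): the digit bounds
`DigitLE t x : ∀ k, v(x_k) ϱ^{k p^k} ≤ t^{p^k}` on `W(R)`, `DigitLT` (strict), critical digits `Crit t x k`
(equality), their behaviour under `x = [x₀] + p · dshift x`, Teichmüller multiples, carries, sums, multiplication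
by `p`, and the **leading-digit stability** `Crit t (x + e) k ↔ Crit t x k` for `DigitLE t x`, `DigitLT t e`
(the carries of Witt addition are sub-critical).  Infrastructure for the Frobenius of `A_max`. [folklore]
-/

namespace Summit.Langlands.Langlands.Theorems.WittDigits

open WittVector NNReal

variable {p : ℕ} [hp : Fact p.Prime] {R : Type*} [CommRing R]

/-- A **digit norm** on `R`: a rank-one valuation `v ≤ 1` with the valuation-ring divisibility property,
together with a base `0 < ϱ < 1` (think `R = 𝒪_{ℂ_p}♭`, `v(x) = ‖x♯‖`, `ϱ = ‖p‖`). [folklore] -/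
structure DigitNorm (R : Type*) [CommRing R] where
  /-- the valuation -/
  v : Valuation R ℝ≥0
  /-- the base -/
  rho : ℝ≥0
  /-- `v ≤ 1` -/
  le_one : ∀ x, v x ≤ 1
  /-- divisibility from valuations -/
  dvd_of_le : ∀ {x y : R}, v x ≤ v y → y ∣ x
  /-- `0 < ϱ` -/
  rho_pos : 0 < rho
  /-- `ϱ < 1` -/
  rho_lt_one : rho < 1

variable (d : DigitNorm R)

/-- `DigitLE d t x`: every digit satisfies `v(x_k) · ϱ^{k p^k} ≤ t^{p^k}`. [folklore] -/
def DigitLE (t : ℝ≥0) (x : WittVector p R) : Prop := ∀ k, d.v (x.coeff k) * d.rho ^ (k * p ^ k) ≤ t ^ p ^ k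

/-- `DigitLT d t x`: the strict version of `DigitLE`. [folklore] -/
def DigitLT (t : ℝ≥0) (x : WittVector p R) : Prop := ∀ k, d.v (x.coeff k) * d.rho ^ (k * p ^ k) < t ^ p ^ k

/-- `Crit d t x k`: the digit `k` of `x` is critical for the threshold `t` (equality in `DigitLE`). [folklore] -/
def Crit (t : ℝ≥0) (x : WittVector p R) (k : ℕ) : Prop := d.v (x.coeff k) * d.rho ^ (k * p ^ k) = t ^ p ^ k

variable {d}

/-- `v x = 0 ↔ x = 0`. [folklore] -/
theorem DigitNorm.v_eq_zero_iff (x : R) : d.v x = 0 ↔ x = 0 := by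
  refine ⟨fun h => ?_, fun h => by rw [h, Valuation.map_zero]⟩
  obtain ⟨c, hc⟩ := d.dvd_of_le (x := x) (y := 0) (by rw [h, Valuation.map_zero])
  rw [hc, zero_mul]

omit hp in
/-- `DigitLT ⇒ DigitLE`. [folklore] -/
theorem DigitLT.le {t : ℝ≥0} {x : WittVector p R} (h : DigitLT d t x) : DigitLE d t x := fun k => (h k).le

omit hp in
/-- Monotonicity in the threshold. [folklore] -/
theorem DigitLE.mono {t t' : ℝ≥0} {x : WittVector p R} (h : DigitLE d t x) (htt' : t ≤ t') : DigitLE d t' x :=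
  fun k => (h k).trans (pow_le_pow_left₀ zero_le htt' _)

omit hp in
/-- Monotonicity in the threshold (strict version). [folklore] -/
theorem DigitLT.mono {t t' : ℝ≥0} {x : WittVector p R} (h : DigitLT d t x) (htt' : t ≤ t') : DigitLT d t' x :=
  fun k => (h k).trans_le (pow_le_pow_left₀ zero_le htt' _)

/-- `DigitLE τ` with `τ < t` gives `DigitLT t`. [folklore] -/
theorem DigitLE.lt_of_lt {τ t : ℝ≥0} {x : WittVector p R} (h : DigitLE d τ x) (hτ : τ < t) : DigitLT d t x :=
  fun k => (h k).trans_lt (pow_lt_pow_left₀ hτ zero_le (pow_ne_zero _ hp.out.ne_zero))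

omit hp in
/-- The basic bound `v(x_k) ϱ^{k p^k} ≤ (ϱ^k)^{p^k} ≤ 1`. [folklore] -/
theorem digit_le_rho_pow (x : WittVector p R) (k : ℕ) :
    d.v (x.coeff k) * d.rho ^ (k * p ^ k) ≤ (d.rho ^ k) ^ p ^ k := by
  rw [← pow_mul]
  exact mul_le_of_le_one_left zero_le (d.le_one _)

omit hp in
/-- Every Witt vector satisfies `DigitLE t` for `t ≥ 1`. [folklore] -/
theorem digitLE_of_one_le {t : ℝ≥0} (ht : 1 ≤ t) (x : WittVector p R) : DigitLE d t x := fun k =>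
  (digit_le_rho_pow x k).trans ((pow_le_one₀ zero_le (pow_le_one₀ zero_le d.rho_lt_one.le)).trans (one_le_pow₀ ht))

/-- At a position `k ≥ 1` no digit is critical for a threshold `t ≥ 1`. [folklore] -/
theorem digit_lt_of_one_le {t : ℝ≥0} (ht : 1 ≤ t) (x : WittVector p R) {k : ℕ} (hk : k ≠ 0) :
    d.v (x.coeff k) * d.rho ^ (k * p ^ k) < t ^ p ^ k :=
  (digit_le_rho_pow x k).trans_lt ((pow_lt_one₀ zero_le (pow_lt_one₀ zero_le d.rho_lt_one hk)
    (pow_ne_zero _ hp.out.ne_zero)).trans_le (one_le_pow₀ ht))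

/-- `DigitLT t 0` for `0 < t`. [folklore] -/
theorem digitLT_zero {t : ℝ≥0} (ht : 0 < t) : DigitLT d t (0 : WittVector p R) := fun k => by
  rw [zero_coeff, Valuation.map_zero, zero_mul]; exact pow_pos ht _

omit hp in
/-- `ϱ^(n+1) ≤ t ⇒ ϱ^n ≤ t/ϱ` and `t ≤ t/ϱ`. [folklore] -/
theorem rho_pow_le_div {n : ℕ} {t : ℝ≥0} (h : d.rho ^ (n + 1) ≤ t) : d.rho ^ n ≤ t / d.rho ∧ t ≤ t / d.rho :=
  ⟨(le_div_iff₀ d.rho_pos).2 (by rwa [← pow_succ]), (le_div_iff₀ d.rho_pos).2 (mul_le_of_le_one_right zero_le d.rho_lt_one.le)⟩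

omit hp in
/-- The threshold identity `t^{p^{k+1}} = ((t/ϱ)^{p^k} ϱ^{p^k})^p`. [folklore] -/
theorem threshold_succ_eq (t : ℝ≥0) (k : ℕ) : t ^ p ^ (k + 1) = ((t / d.rho) ^ p ^ k * d.rho ^ p ^ k) ^ p := by
  rw [← mul_pow, div_mul_cancel₀ t d.rho_pos.ne', ← pow_mul, pow_succ]

/-- `f(s) = (s ϱ^{p^k})^p` is strictly monotone. [folklore] -/
theorem strictMono_aux (k : ℕ) : StrictMono fun s : ℝ≥0 => (s * d.rho ^ p ^ k) ^ p := fun _ _ hab =>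
  pow_lt_pow_left₀ (mul_lt_mul_of_pos_right hab (pow_pos d.rho_pos _)) zero_le hp.out.ne_zero

section CharP

variable [CharP R p]

/-! ### Position `0`, the shift to position `k + 1`, multiplication by `p` -/
/-- The digit-`(k+1)` quantity of `[w] + p y` is `f(v(y_k) ϱ^{k p^k})` with `f(s) = (s ϱ^{p^k})^p`. [folklore] -/
theorem digit_succ_eq (w : R) (y : WittVector p R) (k : ℕ) :
    d.v ((teichmuller p w + (p : WittVector p R) * y).coeff (k + 1)) * d.rho ^ ((k + 1) * p ^ (k + 1)) =
      (d.v (y.coeff k) * d.rho ^ (k * p ^ k) * d.rho ^ p ^ k) ^ p := by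
  rw [coeff_teichmuller_add_mul_succ, Valuation.map_pow, mul_pow, mul_pow, ← pow_mul, ← pow_mul, mul_assoc,
    ← pow_add]
  congr 2; ring

/-- `DigitLE t ([w] + p y) ↔ v w ≤ t ∧ DigitLE (t/ϱ) y`. [folklore] -/
theorem digitLE_teichmuller_add_mul_iff (t : ℝ≥0) (w : R) (y : WittVector p R) :
    DigitLE d t (teichmuller p w + (p : WittVector p R) * y) ↔ d.v w ≤ t ∧ DigitLE d (t / d.rho) y := by
  constructor
  · intro h
    refine ⟨by simpa [coeff_teichmuller_add_mul_zero] using h 0, fun k => ?_⟩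
    have hk := h (k + 1)
    rw [digit_succ_eq, threshold_succ_eq (d := d)] at hk
    exact (strictMono_aux k).le_iff_le.1 hk
  · rintro ⟨h0, h⟩ k
    rcases Nat.eq_zero_or_pos k with rfl | hk
    · simpa [coeff_teichmuller_add_mul_zero] using h0
    · obtain ⟨k, rfl⟩ := Nat.exists_eq_add_one_of_ne_zero hk.ne'
      rw [digit_succ_eq, threshold_succ_eq (d := d)]
      exact (strictMono_aux k).le_iff_le.2 (h k)

/-- `DigitLT t ([w] + p y) ↔ v w < t ∧ DigitLT (t/ϱ) y`. [folklore] -/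
theorem digitLT_teichmuller_add_mul_iff (t : ℝ≥0) (w : R) (y : WittVector p R) :
    DigitLT d t (teichmuller p w + (p : WittVector p R) * y) ↔ d.v w < t ∧ DigitLT d (t / d.rho) y := by
  constructor
  · intro h
    refine ⟨by simpa [coeff_teichmuller_add_mul_zero] using h 0, fun k => ?_⟩
    have hk := h (k + 1)
    rw [digit_succ_eq, threshold_succ_eq (d := d)] at hk
    exact (strictMono_aux k).lt_iff_lt.1 hk
  · rintro ⟨h0, h⟩ k
    rcases Nat.eq_zero_or_pos k with rfl | hk
    · simpa [coeff_teichmuller_add_mul_zero] using h0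
    · obtain ⟨k, rfl⟩ := Nat.exists_eq_add_one_of_ne_zero hk.ne'
      rw [digit_succ_eq, threshold_succ_eq (d := d)]
      exact (strictMono_aux k).lt_iff_lt.2 (h k)

/-- `Crit t ([w] + p y) 0 ↔ v w = t`. [folklore] -/
theorem crit_teichmuller_add_mul_zero_iff (t : ℝ≥0) (w : R) (y : WittVector p R) :
    Crit d t (teichmuller p w + (p : WittVector p R) * y) 0 ↔ d.v w = t := by
  simp [Crit, coeff_teichmuller_add_mul_zero]

/-- `Crit t ([w] + p y) (k+1) ↔ Crit (t/ϱ) y k`. [folklore] -/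
theorem crit_teichmuller_add_mul_succ_iff (t : ℝ≥0) (w : R) (y : WittVector p R) (k : ℕ) :
    Crit d t (teichmuller p w + (p : WittVector p R) * y) (k + 1) ↔ Crit d (t / d.rho) y k := by
  unfold Crit
  rw [digit_succ_eq, threshold_succ_eq (d := d)]
  exact (strictMono_aux k).injective.eq_iff

omit [CharP R p] in
/-- Position `0`: a sub-threshold perturbation does not change criticality. [folklore] -/
theorem crit_zero_add_iff {t : ℝ≥0} {x e : WittVector p R} (hx0 : d.v (x.coeff 0) ≤ t) (he0 : d.v (e.coeff 0) < t) :
    Crit d t (x + e) 0 ↔ Crit d t x 0 := by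
  simp only [Crit, pow_zero, mul_one, pow_one, add_coeff_zero]
  constructor
  · intro h
    by_contra hne
    exact absurd h (((d.v.map_add _ _).trans_lt (max_lt (lt_of_le_of_ne hx0 hne) he0)).ne)
  · intro h
    rw [← h] at he0
    rw [d.v.map_add_eq_of_lt_left he0, h]

/-- `DigitLE t (p x) ↔ DigitLE (t/ϱ) x`. [folklore] -/
theorem digitLE_p_mul_iff (t : ℝ≥0) (x : WittVector p R) :
    DigitLE d t ((p : WittVector p R) * x) ↔ DigitLE d (t / d.rho) x := by
  have h := digitLE_teichmuller_add_mul_iff (d := d) t (0 : R) x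
  rw [teichmuller_zero, zero_add, Valuation.map_zero] at h
  exact h.trans (and_iff_right zero_le)

/-- `DigitLT t (p x) ↔ 0 < t ∧ DigitLT (t/ϱ) x`. [folklore] -/
theorem digitLT_p_mul_iff (t : ℝ≥0) (x : WittVector p R) :
    DigitLT d t ((p : WittVector p R) * x) ↔ 0 < t ∧ DigitLT d (t / d.rho) x := by
  have h := digitLT_teichmuller_add_mul_iff (d := d) t (0 : R) x
  rwa [teichmuller_zero, zero_add, Valuation.map_zero] at h

/-- `Crit t (p x) (k+1) ↔ Crit (t/ϱ) x k`. [folklore] -/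
theorem crit_p_mul_succ_iff (t : ℝ≥0) (x : WittVector p R) (k : ℕ) :
    Crit d t ((p : WittVector p R) * x) (k + 1) ↔ Crit d (t / d.rho) x k := by
  have h := crit_teichmuller_add_mul_succ_iff (d := d) t (0 : R) x k
  rwa [teichmuller_zero, zero_add] at h

end CharP

section Perfect

variable [CharP R p] [PerfectRing R p]

/-! ### The digit shift, Teichmüller multiples, carries -/
/-- `DigitLE t x ↔ v x₀ ≤ t ∧ DigitLE (t/ϱ) (dshift x)`. [folklore] -/
theorem digitLE_iff_dshift (t : ℝ≥0) (x : WittVector p R) :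
    DigitLE d t x ↔ d.v (x.coeff 0) ≤ t ∧ DigitLE d (t / d.rho) (dshift x) := by
  conv_lhs => rw [eq_teichmuller_add_mul_dshift x]
  exact digitLE_teichmuller_add_mul_iff t _ _

/-- `DigitLT t x ↔ v x₀ < t ∧ DigitLT (t/ϱ) (dshift x)`. [folklore] -/
theorem digitLT_iff_dshift (t : ℝ≥0) (x : WittVector p R) :
    DigitLT d t x ↔ d.v (x.coeff 0) < t ∧ DigitLT d (t / d.rho) (dshift x) := by
  conv_lhs => rw [eq_teichmuller_add_mul_dshift x]
  exact digitLT_teichmuller_add_mul_iff t _ _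

/-- `Crit t x (k+1) ↔ Crit (t/ϱ) (dshift x) k`. [folklore] -/
theorem crit_succ_iff_dshift (t : ℝ≥0) (x : WittVector p R) (k : ℕ) :
    Crit d t x (k + 1) ↔ Crit d (t / d.rho) (dshift x) k := by
  conv_lhs => rw [eq_teichmuller_add_mul_dshift x]
  exact crit_teichmuller_add_mul_succ_iff t _ _ k

/-- `v s ≤ σ`, `DigitLE τ y` ⇒ `DigitLE (σ τ) ([s] y)`. [folklore] -/
theorem digitLE_teichmuller_mul {s : R} {σ τ : ℝ≥0} (hs : d.v s ≤ σ) {y : WittVector p R} (hy : DigitLE d τ y) :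
    DigitLE d (σ * τ) (teichmuller p s * y) := fun k => by
  rw [coeff_teichmuller_mul, Valuation.map_mul, Valuation.map_pow, mul_assoc, mul_pow]
  exact mul_le_mul' (pow_le_pow_left₀ zero_le hs _) (hy k)

/-- The digits of `carry 1 w` have valuation `< 1` when `v w < 1`. [folklore] -/
theorem v_coeff_carry_one_lt {w : R} (hw : d.v w < 1) (k : ℕ) : d.v ((carry 1 w : WittVector p R).coeff k) < 1 := by
  obtain ⟨r, hr⟩ := Ideal.mem_span_singleton'.1 (coeff_carry_pow_mem (p := p) (1 : R) w k)
  by_contra hge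
  have h1 : (1 : ℝ≥0) ≤ d.v ((carry 1 w : WittVector p R).coeff k) ^ p := one_le_pow₀ (le_of_not_gt hge)
  rw [← Valuation.map_pow, ← hr, Valuation.map_mul] at h1
  exact absurd (h1.trans (mul_le_of_le_one_left zero_le (d.le_one r))) (not_le.2 hw)

/-- `x + y = [x₀ + y₀] + p · (carry x₀ y₀ + (dshift x + dshift y))`. [folklore] -/
theorem add_eq_teichmuller_add_mul (x y : WittVector p R) :
    x + y = teichmuller p (x.coeff 0 + y.coeff 0) +
      (p : WittVector p R) * (carry (x.coeff 0) (y.coeff 0) + (dshift x + dshift y)) := by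
  conv_lhs => rw [eq_teichmuller_add_mul_dshift x, eq_teichmuller_add_mul_dshift y]
  rw [show teichmuller p (x.coeff 0) + (p : WittVector p R) * dshift x +
        (teichmuller p (y.coeff 0) + (p : WittVector p R) * dshift y)
      = (teichmuller p (x.coeff 0) + teichmuller p (y.coeff 0)) + (p : WittVector p R) * (dshift x + dshift y) by ring,
    teichmuller_add_teichmuller]
  ring

variable [IsDomain R]

/-- **Weak carry bound**: `v u ≤ t`, `v u' ≤ t` ⇒ `DigitLE t (carry u u')`. [folklore] -/
theorem digitLE_carry {t : ℝ≥0} {u u' : R} (hu : d.v u ≤ t) (hu' : d.v u' ≤ t) :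
    DigitLE d t (carry u u' : WittVector p R) := by
  wlog h : d.v u' ≤ d.v u generalizing u u'
  · rw [carry_comm]; exact this hu' hu (le_of_not_ge h)
  obtain ⟨w, rfl⟩ := d.dvd_of_le h
  rw [carry_mul_right]
  simpa using digitLE_teichmuller_mul hu (digitLE_of_one_le le_rfl (carry 1 w))

/-- **Strict carry bound**: `0 < t`, `v u ≤ t`, `v u' < t` ⇒ `DigitLT t (carry u u')`. [folklore] -/
theorem digitLT_carry {t : ℝ≥0} (ht : 0 < t) {u u' : R} (hu : d.v u ≤ t) (hu' : d.v u' < t) :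
    DigitLT d t (carry u u' : WittVector p R) := by
  rcases lt_or_ge (d.v u') (d.v u) with h | h
  · -- `u' = u w` with `v w < 1`
    obtain ⟨w, rfl⟩ := d.dvd_of_le h.le
    have hu0 : 0 < d.v u := lt_of_le_of_lt zero_le h
    have hw : d.v w < 1 := by
      rw [Valuation.map_mul] at h
      by_contra hw
      exact absurd (le_mul_of_one_le_right zero_le (le_of_not_gt hw)) (not_le.2 h)
    rw [carry_mul_right]
    intro k
    rw [coeff_teichmuller_mul, Valuation.map_mul, Valuation.map_pow, mul_assoc]
    calc d.v u ^ p ^ k * (d.v ((carry 1 w : WittVector p R).coeff k) * d.rho ^ (k * p ^ k))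
        < d.v u ^ p ^ k * 1 := by
          refine mul_lt_mul_of_pos_left ?_ (pow_pos hu0 _)
          exact (mul_le_of_le_one_right zero_le (pow_le_one₀ zero_le d.rho_lt_one.le)).trans_lt
            (v_coeff_carry_one_lt hw k)
      _ ≤ t ^ p ^ k := by rw [mul_one]; exact pow_le_pow_left₀ zero_le hu _
  · -- `v u ≤ v u' < t`
    by_cases hu'0 : u' = 0
    · subst hu'0
      have hu0 : u = 0 := by
        rw [Valuation.map_zero, nonpos_iff_eq_zero, DigitNorm.v_eq_zero_iff] at h; exact h
      subst hu0
      have : (carry (0 : R) 0 : WittVector p R) = 0 := by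
        have e := teichmuller_add_teichmuller (p := p) (0 : R) 0
        rw [add_zero, teichmuller_zero, add_zero, zero_add, zero_eq_mul] at e
        exact e.resolve_left natCast_p_ne_zero
      rw [this]; exact digitLT_zero ht
    obtain ⟨w, rfl⟩ := d.dvd_of_le h
    rw [carry_comm, carry_mul_right]
    intro k
    rw [coeff_teichmuller_mul, Valuation.map_mul, Valuation.map_pow, mul_assoc]
    calc d.v u' ^ p ^ k * (d.v ((carry 1 w : WittVector p R).coeff k) * d.rho ^ (k * p ^ k))
        ≤ d.v u' ^ p ^ k * 1 :=
          mul_le_mul_of_nonneg_left ((digit_le_rho_pow _ k).trans (pow_le_one₀ zero_le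
            (pow_le_one₀ zero_le d.rho_lt_one.le))) zero_le
      _ < t ^ p ^ k := by rw [mul_one]; exact pow_lt_pow_left₀ hu' zero_le (pow_ne_zero _ hp.out.ne_zero)

/-! ### Sums and leading-digit stability -/
/-- **Additivity**: `DigitLE t` is closed under addition (induction on the threshold, via the carry bound). [folklore] -/
theorem DigitLE.add_aux : ∀ (n : ℕ) (t : ℝ≥0), d.rho ^ n ≤ t →
    ∀ x y : WittVector p R, DigitLE d t x → DigitLE d t y → DigitLE d t (x + y) := by
  intro n
  induction n with
  | zero => intro t ht x y _ _; rw [pow_zero] at ht; exact digitLE_of_one_le ht _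
  | succ n ih =>
    intro t ht x y hx hy
    obtain ⟨hn, htt⟩ := rho_pow_le_div ht
    have hx0 : d.v (x.coeff 0) ≤ t := ((digitLE_iff_dshift t x).1 hx).1
    have hy0 : d.v (y.coeff 0) ≤ t := ((digitLE_iff_dshift t y).1 hy).1
    rw [add_eq_teichmuller_add_mul, digitLE_teichmuller_add_mul_iff]
    refine ⟨(d.v.map_add _ _).trans (max_le hx0 hy0), ih _ hn _ _ ((digitLE_carry hx0 hy0).mono htt) ?_⟩
    exact ih _ hn _ _ ((digitLE_iff_dshift t x).1 hx).2 ((digitLE_iff_dshift t y).1 hy).2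

/-- **Additivity** of `DigitLE t` (`0 < t`). [folklore] -/
theorem DigitLE.add {t : ℝ≥0} (ht : 0 < t) {x y : WittVector p R} (hx : DigitLE d t x) (hy : DigitLE d t y) :
    DigitLE d t (x + y) := by
  obtain ⟨n, hn⟩ := _root_.exists_pow_lt_of_lt_one ht d.rho_lt_one
  exact DigitLE.add_aux n t hn.le x y hx hy

/-- **Additivity** of the strict bound `DigitLT t`. [folklore] -/
theorem DigitLT.add_aux : ∀ (n : ℕ) (t : ℝ≥0), d.rho ^ n ≤ t →
    ∀ x y : WittVector p R, DigitLT d t x → DigitLT d t y → DigitLT d t (x + y) := by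
  intro n
  induction n with
  | zero =>
    intro t ht x y hx hy k
    rw [pow_zero] at ht
    rcases Nat.eq_zero_or_pos k with rfl | hk
    · have hx0 := hx 0
      have hy0 := hy 0
      simp only [pow_zero, mul_one, pow_one, add_coeff_zero] at hx0 hy0 ⊢
      exact (d.v.map_add _ _).trans_lt (max_lt hx0 hy0)
    · exact digit_lt_of_one_le ht _ hk.ne'
  | succ n ih =>
    intro t ht x y hx hy
    obtain ⟨hn, htt⟩ := rho_pow_le_div ht
    have ht0 : 0 < t := lt_of_lt_of_le (pow_pos d.rho_pos _) ht
    have hx0 : d.v (x.coeff 0) < t := ((digitLT_iff_dshift t x).1 hx).1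
    have hy0 : d.v (y.coeff 0) < t := ((digitLT_iff_dshift t y).1 hy).1
    rw [add_eq_teichmuller_add_mul, digitLT_teichmuller_add_mul_iff]
    refine ⟨(d.v.map_add _ _).trans_lt (max_lt hx0 hy0), ih _ hn _ _ ((digitLT_carry ht0 hx0.le hy0).mono htt) ?_⟩
    exact ih _ hn _ _ ((digitLT_iff_dshift t x).1 hx).2 ((digitLT_iff_dshift t y).1 hy).2

/-- **Additivity** of `DigitLT t` (`0 < t`). [folklore] -/
theorem DigitLT.add {t : ℝ≥0} (ht : 0 < t) {x y : WittVector p R} (hx : DigitLT d t x) (hy : DigitLT d t y) :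
    DigitLT d t (x + y) := by
  obtain ⟨n, hn⟩ := _root_.exists_pow_lt_of_lt_one ht d.rho_lt_one
  exact DigitLT.add_aux n t hn.le x y hx hy

/-- **Leading-digit stability**: for `DigitLE t x` and a perturbation `e` with `DigitLT t e`, the digit `k` of
`x + e` is critical iff the digit `k` of `x` is (the carries of Witt addition are sub-critical). [folklore] -/
theorem crit_add_iff_aux : ∀ (n : ℕ) (t : ℝ≥0), d.rho ^ n ≤ t →
    ∀ x e : WittVector p R, DigitLE d t x → DigitLT d t e → ∀ k, (Crit d t (x + e) k ↔ Crit d t x k) := by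
  intro n
  induction n with
  | zero =>
    intro t ht x e hx he k
    rw [pow_zero] at ht
    rcases Nat.eq_zero_or_pos k with rfl | hk
    · exact crit_zero_add_iff ((digitLE_iff_dshift t x).1 hx).1 ((digitLT_iff_dshift t e).1 he).1
    · exact iff_of_false (digit_lt_of_one_le ht _ hk.ne').ne (digit_lt_of_one_le ht _ hk.ne').ne
  | succ n ih =>
    intro t ht x e hx he k
    obtain ⟨hn, htt⟩ := rho_pow_le_div ht
    have ht0 : 0 < t := lt_of_lt_of_le (pow_pos d.rho_pos _) ht
    obtain ⟨hx0, hx'⟩ := (digitLE_iff_dshift t x).1 hx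
    obtain ⟨he0, he'⟩ := (digitLT_iff_dshift t e).1 he
    rcases Nat.eq_zero_or_pos k with rfl | hk
    · exact crit_zero_add_iff hx0 he0
    obtain ⟨k, rfl⟩ := Nat.exists_eq_add_one_of_ne_zero hk.ne'
    rw [crit_succ_iff_dshift t x k, add_eq_teichmuller_add_mul, crit_teichmuller_add_mul_succ_iff,
      show carry (x.coeff 0) (e.coeff 0) + (dshift x + dshift e) =
        dshift x + (dshift e + carry (x.coeff 0) (e.coeff 0)) by ring]
    exact ih _ hn _ _ hx' (DigitLT.add_aux n _ hn _ _ he' ((digitLT_carry ht0 hx0 he0).mono htt)) k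

/-- **Leading-digit stability** (`0 < t`). [folklore] -/
theorem crit_add_iff {t : ℝ≥0} (ht : 0 < t) {x e : WittVector p R} (hx : DigitLE d t x) (he : DigitLT d t e) (k : ℕ) :
    Crit d t (x + e) k ↔ Crit d t x k := by
  obtain ⟨n, hn⟩ := _root_.exists_pow_lt_of_lt_one ht d.rho_lt_one
  exact crit_add_iff_aux n t hn.le x e hx he k

end Perfect

end Summit.Langlands.Langlands.Theorems.WittDigits
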